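import Summits.MatrixMultiplication.OmegaCensus.STPPKernelListerReal
import Summits.MatrixMultiplication.OmegaCensus.STPPKernelListerBound

/-!
# ω-census (abelian STPP census): kernel lister — the search state of a pattern, and the budget facts of `SearchHyp` (kernel)

HONEST FRAMING (pub-omega census; verbatim): lottery ticket; floor = certified bounds/negative ranges.
Census STRUCTURE (seat pub-omega-stpp-2 gen 29, 2026-08-29), family (b2).  Nothing here is progress on `ω`.

`stOf n P` = the state the lister computes along the pattern `P` (`P.foldl St.add St.init`), with closed forms for every field (sums, minima, the
truncated-subtraction budgets); `Bad n H P` = «`P` is realised in `H`, beating (`Σ vol > n`) and minimal (`Σ vol ≤ n + min minprod`)»; and the facts of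
`SearchHypH` (`STPPKernelListerScanSoundH.lean`) that follow from the list-sum laws of `STPPKernelListerReal.lean`: `nonbeating`, `misfit` (via
`fits_of_realizable`), `overshoot`, `exhausted`, `prefix_beating`, `prune` (via the coverage `CovC` of `STPPKernelListerBound.lean`), `add`, for the invariant
`Inv st P := st = stOf n P ∧ every block of P admissible` and the universe `U` of admissible shapes.  The remaining field `leaf` (the list-native filters and
the canonical dead test) is the sibling file `STPPKernelListerLeaf.lean`.
-/

open Finset

namespace Summit.MatrixMultiplication.OmegaCensus.KLister

/-! ## The state of a pattern -/

/-- The lister's state after the blocks of `P` (in order). [folklore] -/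
def stOf (n : ℕ) (P : List Shape) : St := P.foldl (St.add n) (St.init n)

/-- `stOf` of `[]`. [folklore] -/
@[simp] theorem stOf_nil (n : ℕ) : stOf n [] = St.init n := rfl

/-- `stOf` of `P ++ [s]`. [folklore] -/
theorem stOf_append (n : ℕ) (P : List Shape) (s : Shape) : stOf n (P ++ [s]) = (stOf n P).add n s := by
  simp [stOf, List.foldl_append]

/-- `min` over a list with a seed. [folklore] -/
def lmin (seed : ℕ) (l : List ℕ) : ℕ := l.foldl min seed

/-- `lmin` of an append. [folklore] -/
theorem lmin_append (seed : ℕ) (l : List ℕ) (x : ℕ) : lmin seed (l ++ [x]) = min (lmin seed l) x := by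
  simp [lmin, List.foldl_append]

/-- `lmin` is below the seed. [folklore] -/
theorem lmin_le_seed (seed : ℕ) : ∀ l : List ℕ, lmin seed l ≤ seed := by
  intro l
  induction l using List.reverseRecOn with
  | nil => simp [lmin]
  | append_singleton l x ih => rw [lmin_append]; exact (min_le_left _ _).trans ih

/-- `lmin` is below every member. [folklore] -/
theorem lmin_le_mem (seed : ℕ) : ∀ l : List ℕ, ∀ x ∈ l, lmin seed l ≤ x := by
  intro l
  induction l using List.reverseRecOn with
  | nil => simp
  | append_singleton l y ih =>
    intro x hx
    rw [lmin_append]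
    rcases List.mem_append.1 hx with hx | hx
    · exact (min_le_left _ _).trans (ih x hx)
    · rw [List.mem_singleton] at hx; subst hx; exact min_le_right _ _

/-- `lmin` is the seed or a member. [folklore] -/
theorem lmin_cases (seed : ℕ) : ∀ l : List ℕ, lmin seed l = seed ∨ lmin seed l ∈ l := by
  intro l
  induction l using List.reverseRecOn with
  | nil => simp [lmin]
  | append_singleton l y ih =>
    rw [lmin_append]
    rcases le_total (lmin seed l) y with h | h
    · rw [min_eq_left h]
      rcases ih with h' | h'
      · exact Or.inl h'
      · exact Or.inr (List.mem_append_left _ h')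
    · rw [min_eq_right h]; exact Or.inr (List.mem_append_right _ (List.mem_singleton_self _))

/-- `lmin` is antitone under appending. [folklore] -/
theorem lmin_append_le (seed : ℕ) (l m : List ℕ) : lmin seed (l ++ m) ≤ lmin seed l := by
  induction m using List.reverseRecOn with
  | nil => simp
  | append_singleton m y ih => rw [← List.append_assoc, lmin_append]; exact (min_le_left _ _).trans ih

/-- **Closed form of the state.** [folklore] -/
theorem stOf_eq (n : ℕ) : ∀ P : List Shape, stOf n P =
    { vol := sumVol P, sab := (P.map pab).sum, sbc := (P.map pbc).sum, sca := (P.map pca).sum, smf := (P.map maxflat).sum,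
      mina := lmin (n + 1) (P.map fun s => s.1), minb := lmin (n + 1) (P.map fun s => s.2.1), minc := lmin (n + 1) (P.map fun s => s.2.2),
      mm := lmin (n + 1) (P.map minprod), has0 := !P.isEmpty,
      r7 := (match P with | [] => n | h :: T => n - rlb h - (T.map maxflat).sum),
      ra := (match P with | [] => n | h :: T => n - svol h - (T.map qa).sum),
      rb := (match P with | [] => n | h :: T => n - svol h - (T.map qb).sum),
      rc := (match P with | [] => n | h :: T => n - svol h - (T.map qc).sum) } := by
  intro P
  induction P using List.reverseRecOn with
  | nil => rfl
  | append_singleton P s ih =>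
    rw [stOf_append, ih]
    cases P with
    | nil =>
      simp only [St.add, sumVol, lmin, List.map_nil, List.sum_nil, List.foldl_nil, List.map_cons, List.sum_cons, List.foldl_cons,
        List.isEmpty_nil, List.nil_append, List.isEmpty_cons, Bool.not_true, Bool.not_false, Bool.false_eq_true, ↓reduceIte, Nat.add_zero,
        Nat.zero_add, Nat.sub_zero]
    | cons h T =>
      -- the minima: `lmin seed (l ++ [x]) = min (lmin seed l) x`
      simp only [List.map_append, List.map_cons, List.map_nil, lmin_append]
      -- the sums and the budgets
      simp only [St.add, sumVol_append, sumVol_cons, sumVol_nil, List.sum_append, List.sum_cons, List.sum_nil, List.isEmpty_cons,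
        List.cons_append, Bool.not_false, ↓reduceIte, St.mk.injEq, Nat.add_zero]
      simp only [List.map_append, List.map_cons, List.map_nil, List.sum_append, List.sum_cons, List.sum_nil, Nat.add_zero]
      refine ⟨?_, ?_, ?_, ?_, ?_, ?_, ?_, ?_, ?_, ?_, ?_, ?_, ?_, ?_⟩ <;> first | trivial | rfl | omega

/-- The volume field. [folklore] -/
theorem stOf_vol (n : ℕ) (P : List Shape) : (stOf n P).vol = sumVol P := by rw [stOf_eq]
/-- The `Σab` field. [folklore] -/
theorem stOf_sab (n : ℕ) (P : List Shape) : (stOf n P).sab = (P.map pab).sum := by rw [stOf_eq]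
/-- The `Σbc` field. [folklore] -/
theorem stOf_sbc (n : ℕ) (P : List Shape) : (stOf n P).sbc = (P.map pbc).sum := by rw [stOf_eq]
/-- The `Σca` field. [folklore] -/
theorem stOf_sca (n : ℕ) (P : List Shape) : (stOf n P).sca = (P.map pca).sum := by rw [stOf_eq]
/-- The `Σmaxflat` field. [folklore] -/
theorem stOf_smf (n : ℕ) (P : List Shape) : (stOf n P).smf = (P.map maxflat).sum := by rw [stOf_eq]
/-- The `min a` field. [folklore] -/
theorem stOf_mina (n : ℕ) (P : List Shape) : (stOf n P).mina = lmin (n + 1) (P.map fun s => s.1) := by rw [stOf_eq]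
/-- The `min b` field. [folklore] -/
theorem stOf_minb (n : ℕ) (P : List Shape) : (stOf n P).minb = lmin (n + 1) (P.map fun s => s.2.1) := by rw [stOf_eq]
/-- The `min c` field. [folklore] -/
theorem stOf_minc (n : ℕ) (P : List Shape) : (stOf n P).minc = lmin (n + 1) (P.map fun s => s.2.2) := by rw [stOf_eq]
/-- The minimality-margin field. [folklore] -/
theorem stOf_mm (n : ℕ) (P : List Shape) : (stOf n P).mm = lmin (n + 1) (P.map minprod) := by rw [stOf_eq]
/-- The `has0` field. [folklore] -/
theorem stOf_has0 (n : ℕ) (P : List Shape) : (stOf n P).has0 = !P.isEmpty := by rw [stOf_eq]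
/-- The N7 budget after a first block. [folklore] -/
theorem stOf_r7 (n : ℕ) (h : Shape) (T : List Shape) : (stOf n (h :: T)).r7 = n - rlb h - (T.map maxflat).sum := by rw [stOf_eq]
/-- The N16 `A`-budget after a first block. [folklore] -/
theorem stOf_ra (n : ℕ) (h : Shape) (T : List Shape) : (stOf n (h :: T)).ra = n - svol h - (T.map qa).sum := by rw [stOf_eq]
/-- The N16 `B`-budget after a first block. [folklore] -/
theorem stOf_rb (n : ℕ) (h : Shape) (T : List Shape) : (stOf n (h :: T)).rb = n - svol h - (T.map qb).sum := by rw [stOf_eq]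
/-- The N16 `C`-budget after a first block. [folklore] -/
theorem stOf_rc (n : ℕ) (h : Shape) (T : List Shape) : (stOf n (h :: T)).rc = n - svol h - (T.map qc).sum := by rw [stOf_eq]

/-! ## Bad patterns and the invariant -/

/-- All blocks admissible for order `n`. [folklore] -/
def AllAdm (n : ℕ) (P : List Shape) : Prop := ∀ t ∈ P, adm n t = true

/-- **Bad pattern**: realised in `H`, beating (`Σ vol > n`) and minimal (`Σ vol ≤ n + min minprod`). [folklore] -/
def Bad (n : ℕ) (H : Type*) [AddCommGroup H] (P : List Shape) : Prop :=
  Realizable H P ∧ n < sumVol P ∧ sumVol P ≤ n + lmin (n + 1) (P.map minprod)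

/-- **The invariant**: the state is the one computed from the pattern, and all blocks are admissible. [folklore] -/
def Inv (n : ℕ) (st : St) (P : List Shape) : Prop := st = stOf n P ∧ AllAdm n P

variable {H : Type*} [AddCommGroup H] [Fintype H] {n : ℕ}

/-- `sumVol` is the `svol`-sum. [folklore] -/
theorem sumVol_eq_sum (P : List Shape) : sumVol P = (P.map svol).sum := rfl

/-- Unfolding an admissible shape. [folklore] -/
theorem adm_iff {n : ℕ} {s : Shape} : adm n s = true ↔ 1 ≤ s.1 ∧ 1 ≤ s.2.1 ∧ 1 ≤ s.2.2 ∧ pab s ≤ n ∧ pbc s ≤ n ∧ pca s ≤ n ∧ svol s ≤ n := by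
  simp [adm]

/-- An admissible shape has `ab ≥ 1`. [folklore] -/
theorem one_le_pab_of_adm {n : ℕ} {s : Shape} (h : adm n s = true) : 1 ≤ pab s := by
  rw [adm_iff] at h; exact Nat.mul_pos h.1 h.2.1
/-- An admissible shape has `minprod ≤ vol`. [folklore] -/
theorem minprod_le_svol_of_adm {n : ℕ} {s : Shape} (h : adm n s = true) : minprod s ≤ svol s := by
  rw [adm_iff] at h
  obtain ⟨_, _, h3, -⟩ := h
  calc minprod s ≤ pab s := min_le_left _ _
    _ = s.1 * s.2.1 * 1 := (mul_one _).symm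
    _ ≤ s.1 * s.2.1 * s.2.2 := Nat.mul_le_mul_left _ h3

/-- A sum over a sublist of terms is bounded by the full sum: member ≤ sum. [folklore] -/
theorem le_sum_of_mem {l : List Shape} {t : Shape} (f : Shape → ℕ) (h : t ∈ l) : f t ≤ (l.map f).sum :=
  List.single_le_sum (fun _ _ => Nat.zero_le _) _ (List.mem_map_of_mem h)

/-! ## The facts of `SearchHypH` that follow from the laws -/

omit [Fintype H] in
/-- **nonbeating**. [folklore] -/
theorem nonbeating_inst {st : St} {P : List Shape} (hI : Inv n st P) (hv : st.vol ≤ n) : ¬ Bad n H P := by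
  rintro ⟨-, hb, -⟩
  rw [hI.1, stOf_vol] at hv
  omega

omit [Fintype H] in
/-- **overshoot**. [folklore] -/
theorem overshoot_inst {st : St} {P : List Shape} {s : Shape} {E' : List Shape} (hI : Inv n st P)
    (h : n + min st.mm (minprod s) < st.vol + svol s) : ¬ Bad n H (P ++ s :: E') := by
  rintro ⟨-, -, hmin⟩
  rw [hI.1, stOf_vol, stOf_mm] at h
  have h1 : lmin (n + 1) ((P ++ s :: E').map minprod) ≤ lmin (n + 1) (P.map minprod) := by
    rw [List.map_append]; exact lmin_append_le _ _ _
  have h2 : lmin (n + 1) ((P ++ s :: E').map minprod) ≤ minprod s :=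
    lmin_le_mem _ _ _ (List.mem_map_of_mem (by simp))
  have h3 : sumVol P + svol s ≤ sumVol (P ++ s :: E') := by rw [sumVol_append, sumVol_cons]; omega
  have h4 := le_min h1 h2
  omega

/-- **exhausted** (for an admissible `s`). [folklore] -/
theorem exhausted_inst (hn : Fintype.card H = n) {st : St} {P : List Shape} {s : Shape} {E' : List Shape} (hs : adm n s = true)
    (hI : Inv n st P) (h : n ≤ st.sab) : ¬ Bad n H (P ++ s :: E') := by
  rintro ⟨hR, -, -⟩
  have h1 := hR.sum_pab_le
  rw [hn, List.map_append, List.map_cons, List.sum_append, List.sum_cons] at h1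
  rw [hI.1, stOf_sab] at h
  have h2 := one_le_pab_of_adm hs
  omega

/-- **prefix_beating**: a proper extension of a beating pattern is not minimal. [folklore] -/
theorem prefix_beating_inst {st : St} {P : List Shape} {E' : List Shape} (hI : Inv n st P) (hv : n < st.vol) (hE : E' ≠ []) :
    ¬ Bad n H (P ++ E') := by
  rintro ⟨hR, -, hmin⟩
  obtain ⟨e, E'', rfl⟩ := List.exists_cons_of_ne_nil hE
  rw [hI.1, stOf_vol] at hv
  have hadm : adm (Fintype.card H) e = true := hR.adm e (by simp)
  have h1 : minprod e ≤ svol e := minprod_le_svol_of_adm hadm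
  have h2 : lmin (n + 1) ((P ++ e :: E'').map minprod) ≤ minprod e := lmin_le_mem _ _ _ (List.mem_map_of_mem (by simp))
  rw [sumVol_append, sumVol_cons] at hmin
  omega

/-- **add** (for an admissible `s`). [folklore] -/
theorem add_inst {st : St} {P : List Shape} {s : Shape} (hs : adm n s = true) (hI : Inv n st P) :
    Inv n (st.add n s) (P ++ [s]) ∧ st.sab + 1 ≤ (st.add n s).sab ∧ (st.add n s).has0 = true := by
  refine ⟨⟨by rw [hI.1, stOf_append], fun t ht => ?_⟩, ?_, rfl⟩
  · rcases List.mem_append.1 ht with ht | ht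
    · exact hI.2 t ht
    · rw [List.mem_singleton] at ht; subst ht; exact hs
  · have := one_le_pab_of_adm hs
    show st.sab + 1 ≤ st.sab + pab s
    omega

/-! ## `fits` holds along every realisable extension (⇒ misfit) -/

/-- **Every conjunct of `St.fits` is a law**: if `P ++ s :: E'` is realised in `H` (`|H| = n`), then `(stOf n P).fits n s = true`. [folklore] -/
theorem fits_of_realizable (hn : Fintype.card H = n) {P : List Shape} {s : Shape} {E' : List Shape} (hR : Realizable H (P ++ s :: E')) :
    (stOf n P).fits n s = true := by
  have hsQ : s ∈ P ++ s :: E' := by simp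
  have Lab := hR.sum_pab_le; have Lbc := hR.sum_pbc_le; have Lca := hR.sum_pca_le; have Lmf := hR.sum_maxflat_le
  have Rb := hR.rep_b; have Rc := hR.rep_c; have Ra := hR.rep_a
  have N7 := hR.rlb_add_sum_maxflat_le; have Na := hR.n16_a; have Nb := hR.n16_b; have Nc := hR.n16_c
  rw [hn] at Lab Lbc Lca Lmf Rb Rc Ra N7 Na Nb Nc
  simp only [List.map_append, List.map_cons, List.sum_append, List.sum_cons] at Lab Lbc Lca Lmf Rb Rc Ra N7 Na Nb Nc
  -- the representation-count budgets: the current minimum is `n + 1` or attained at a block of `P`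
  have hb : (P.map pab).sum + pab s + ((P.map pbc).sum + pbc s) ≤ n + min (lmin (n + 1) (P.map fun t => t.2.1)) s.2.1 := by
    have h1 := Rb s hsQ
    rcases lmin_cases (n + 1) (P.map fun t => t.2.1) with h | h
    · rw [h]; have := Nat.le_min.2 ⟨(by omega : _ ≤ n + (n + 1)), (by omega : (P.map pab).sum + pab s + ((P.map pbc).sum + pbc s) ≤ n + s.2.1)⟩
      simpa [Nat.add_min_add_left] using this
    · obtain ⟨t, ht, hte⟩ := List.mem_map.1 h
      have h2 := Rb t (List.mem_append_left _ ht)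
      rw [← hte]
      have := Nat.le_min.2 ⟨(by omega : (P.map pab).sum + pab s + ((P.map pbc).sum + pbc s) ≤ n + t.2.1), (by omega : _ ≤ n + s.2.1)⟩
      simpa [Nat.add_min_add_left] using this
  have hc : (P.map pbc).sum + pbc s + ((P.map pca).sum + pca s) ≤ n + min (lmin (n + 1) (P.map fun t => t.2.2)) s.2.2 := by
    have h1 := Rc s hsQ
    rcases lmin_cases (n + 1) (P.map fun t => t.2.2) with h | h
    · rw [h]; have := Nat.le_min.2 ⟨(by omega : _ ≤ n + (n + 1)), (by omega : (P.map pbc).sum + pbc s + ((P.map pca).sum + pca s) ≤ n + s.2.2)⟩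
      simpa [Nat.add_min_add_left] using this
    · obtain ⟨t, ht, hte⟩ := List.mem_map.1 h
      have h2 := Rc t (List.mem_append_left _ ht)
      rw [← hte]
      have := Nat.le_min.2 ⟨(by omega : (P.map pbc).sum + pbc s + ((P.map pca).sum + pca s) ≤ n + t.2.2), (by omega : _ ≤ n + s.2.2)⟩
      simpa [Nat.add_min_add_left] using this
  have ha : (P.map pca).sum + pca s + ((P.map pab).sum + pab s) ≤ n + min (lmin (n + 1) (P.map fun t => t.1)) s.1 := by
    have h1 := Ra s hsQ
    rcases lmin_cases (n + 1) (P.map fun t => t.1) with h | h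
    · rw [h]; have := Nat.le_min.2 ⟨(by omega : _ ≤ n + (n + 1)), (by omega : (P.map pca).sum + pca s + ((P.map pab).sum + pab s) ≤ n + s.1)⟩
      simpa [Nat.add_min_add_left] using this
    · obtain ⟨t, ht, hte⟩ := List.mem_map.1 h
      have h2 := Ra t (List.mem_append_left _ ht)
      rw [← hte]
      have := Nat.le_min.2 ⟨(by omega : (P.map pca).sum + pca s + ((P.map pab).sum + pab s) ≤ n + t.1), (by omega : _ ≤ n + s.1)⟩
      simpa [Nat.add_min_add_left] using this
  rw [stOf_eq]
  cases P with
  | nil =>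
    have h7 := N7 s hsQ
    simp only [St.fits, List.map_nil, List.sum_nil, Nat.zero_add, lmin, List.foldl_nil, List.isEmpty_nil, Bool.not_true, Bool.false_eq_true,
      ↓reduceIte, Bool.and_eq_true, Nat.ble_eq]
    simp only [List.map_nil, List.sum_nil, Nat.zero_add, lmin, List.foldl_nil] at hb hc ha
    refine ⟨⟨⟨⟨⟨⟨⟨by omega, by omega⟩, by omega⟩, by omega⟩, hb⟩, hc⟩, ha⟩, by omega⟩
  | cons h T =>
    have h7 := N7 h (by simp)
    have na := Na h (by simp); have nb := Nb h (by simp); have nc := Nc h (by simp)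
    simp only [List.map_cons, List.sum_cons] at Lab Lbc Lca Lmf h7 na nb nc hb hc ha
    simp only [St.fits, List.map_cons, List.sum_cons, List.isEmpty_cons, Bool.not_false, ↓reduceIte, Bool.and_eq_true, Nat.ble_eq]
    refine ⟨⟨⟨⟨⟨⟨⟨by omega, by omega⟩, by omega⟩, by omega⟩, hb⟩, hc⟩, ha⟩, ⟨⟨⟨by omega, by omega⟩, by omega⟩, by omega⟩⟩

/-- **misfit**. [folklore] -/
theorem misfit_inst (hn : Fintype.card H = n) {st : St} {P : List Shape} {s : Shape} {E' : List Shape} (hI : Inv n st P)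
    (h : st.fits n s = false) : ¬ Bad n H (P ++ s :: E') := by
  rintro ⟨hR, -, -⟩
  have := fits_of_realizable hn hR
  rw [← hI.1, h] at this
  exact Bool.false_ne_true this

/-! ## The pruning bound (after the first block) -/

/-- The `i`-th cost sums are the named sums. [folklore] -/
theorem sumCost_eq (E : List Shape) :
    sumCost 0 E = (E.map maxflat).sum ∧ sumCost 1 E = (E.map qa).sum ∧ sumCost 2 E = (E.map qb).sum ∧ sumCost 3 E = (E.map qc).sum := by
  have h0 : costI 0 = maxflat := funext fun _ => rfl
  have h1 : costI 1 = qa := funext fun _ => rfl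
  have h2 : costI 2 = qb := funext fun _ => rfl
  have h3 : costI 3 = qc := funext fun _ => rfl
  simp only [sumCost, h0, h1, h2, h3, and_self]

/-- `lmin seed l ≤ n` forces the minimum to be attained in `l` when `n < seed`. [folklore] -/
theorem exists_mem_le_of_lmin_le {seed n : ℕ} {l : List ℕ} (h : lmin seed l ≤ n) (hs : n < seed) : ∃ x ∈ l, x ≤ n := by
  rcases lmin_cases seed l with h' | h'
  · omega
  · exact ⟨_, h', h⟩

/-- **prune**: at a state after the first block, rows covering the remaining shapes bound every realisable extension below the beating threshold.
[folklore] -/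
theorem prune_inst (hn : Fintype.card H = n) {st : St} {P : List Shape} {rows : List ℕ} {R E : List Shape} (hI : Inv n st P)
    (hh : st.has0 = true) (hcov : CovC (2 * n + 2) rows R) (hE : OrdExt R E) (hb : st.vol + bound n st rows ≤ n) : ¬ Bad n H (P ++ E) := by
  rintro ⟨hR, hbeat, -⟩
  obtain ⟨hst, -⟩ := hI
  subst hst
  -- `P` is non-empty
  cases P with
  | nil => simp [St.init] at hh
  | cons h T =>
    have Lmf := hR.sum_maxflat_le
    have N7 := hR.rlb_add_sum_maxflat_le h (by simp)
    have Na := hR.n16_a h (by simp); have Nb := hR.n16_b h (by simp); have Nc := hR.n16_c h (by simp)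
    rw [hn] at Lmf N7 Na Nb Nc
    simp only [List.cons_append, List.map_cons, List.map_append, List.sum_cons, List.sum_append] at Lmf N7 Na Nb Nc
    obtain ⟨e0, e1, e2, e3⟩ := sumCost_eq E
    -- the four budgets bound the four cost sums of `E`
    have b0 : sumCost 0 E ≤ min (stOf n (h :: T)).r7 (n - (stOf n (h :: T)).smf) := by
      rw [stOf_r7, stOf_smf, e0]; simp only [List.map_cons, List.sum_cons]; apply Nat.le_min.2; constructor <;> omega
    have b1 : sumCost 1 E ≤ (stOf n (h :: T)).ra := by rw [stOf_ra, e1]; omega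
    have b2 : sumCost 2 E ≤ (stOf n (h :: T)).rb := by rw [stOf_rb, e2]; omega
    have b3 : sumCost 3 E ≤ (stOf n (h :: T)).rc := by rw [stOf_rc, e3]; omega
    have hh0 : (stOf n (h :: T)).has0 = true := by rw [stOf_has0]; rfl
    -- each budget is `< 2n+2`
    have w0 : min (stOf n (h :: T)).r7 (n - (stOf n (h :: T)).smf) < 2 * n + 2 := by rw [stOf_r7]; omega
    have w1 : (stOf n (h :: T)).ra < 2 * n + 2 := by rw [stOf_ra]; omega
    have w2 : (stOf n (h :: T)).rb < 2 * n + 2 := by rw [stOf_rb]; omega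
    have w3 : (stOf n (h :: T)).rc < 2 * n + 2 := by rw [stOf_rc]; omega
    have v0 := hcov E hE 0 (by omega) _ w0 b0
    have v1 := hcov E hE 1 (by omega) _ w1 b1
    have v2 := hcov E hE 2 (by omega) _ w2 b2
    have v3 := hcov E hE 3 (by omega) _ w3 b3
    -- `bound` is `n + 1` or one of the four table values
    have hbd : bound n (stOf n (h :: T)) rows = n + 1 ∨ sumVol E ≤ bound n (stOf n (h :: T)) rows := by
      unfold bound
      rw [St.budgets, hh0]
      simp only [↓reduceIte]
      rcases lmin_cases (n + 1) ((List.zip rows [min (stOf n (h :: T)).r7 (n - (stOf n (h :: T)).smf), (stOf n (h :: T)).ra,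
        (stOf n (h :: T)).rb, (stOf n (h :: T)).rc]).map fun p => lk p.1 p.2) with hc | hc
      · exact Or.inl hc
      · right
        obtain ⟨p, hp, hpe⟩ := List.mem_map.1 hc
        change sumVol E ≤ lmin (n + 1) _
        rw [← hpe]
        -- identify which budget `p` is
        obtain ⟨r, b⟩ := p
        have hp' := hp
        rcases rows with _ | ⟨r0, _ | ⟨r1, _ | ⟨r2, _ | ⟨r3, rest⟩⟩⟩⟩
        · simp at hp'
        · simp only [List.zip_cons_cons, List.zip_nil_left, List.mem_cons, Prod.mk.injEq, List.not_mem_nil, or_false] at hp'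
          obtain ⟨rfl, rfl⟩ := hp'; simpa using v0
        · simp only [List.zip_cons_cons, List.zip_nil_left, List.mem_cons, Prod.mk.injEq, List.not_mem_nil, or_false] at hp'
          rcases hp' with ⟨rfl, rfl⟩ | ⟨rfl, rfl⟩
          · simpa using v0
          · simpa using v1
        · simp only [List.zip_cons_cons, List.zip_nil_left, List.mem_cons, Prod.mk.injEq, List.not_mem_nil, or_false] at hp'
          rcases hp' with ⟨rfl, rfl⟩ | ⟨rfl, rfl⟩ | ⟨rfl, rfl⟩
          · simpa using v0
          · simpa using v1
          · simpa using v2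
        · simp only [List.zip_cons_cons, List.zip_nil_right, List.mem_cons, Prod.mk.injEq, List.not_mem_nil, or_false] at hp'
          rcases hp' with ⟨rfl, rfl⟩ | ⟨rfl, rfl⟩ | ⟨rfl, rfl⟩ | ⟨rfl, rfl⟩
          · simpa using v0
          · simpa using v1
          · simpa using v2
          · simpa using v3
    simp only [stOf_vol, List.cons_append, sumVol_cons, sumVol_append] at hb hbeat
    rcases hbd with hbd | hbd <;> omega

/-- **cov_tail** (re-export). [folklore] -/
theorem cov_tail_inst {W : ℕ} {rows : List ℕ} {s : Shape} {R : List Shape} (h : CovC W rows (s :: R)) : CovC W rows R := h.tail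

end Summit.MatrixMultiplication.OmegaCensus.KLister
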